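import Summits.QuantumFields.YangMills.Theorems.LangevinControlUVFemtoCurvatureTwoPointCCornerOneSiteDoubling
import Literature.MathematicalPhysics.QuantumFieldTheory.WilsonEnergyConvexity
import HarnessLib

/-!
# Route `LangevinControlUV`, crux `FemtoCurvatureTwoPointC` (stmt-QuantumFields-16204), line
# `conditional-covariance-floor` — V-corner, input M1: sublevel doubling ⇒ PARTITION-FUNCTION doubling
# on a fixed torus, at EVERY temperature; the one-site case

The recommended route to the uniform corner doubling UDC (notes `Vc-notes.md` of the line; bridge
`…CCornerBridge`, input (i) `…CCornerOneSiteDoubling`) conditions the comb-gauge torus integral on its four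
critical wrap links and squeezes the marginal between ONE-SITE partition functions
`Z₁(b) = partitionFunction (L := 1) r.ρ b` at temperatures differing by a factor `poly(L)`; the mismatch
is paid by ITERATING a one-site doubling `Z₁(b/4) ≤ K·Z₁(b)` valid at every `b > 0`. This file proves
that doubling, with no threshold in `b`:

* `OneSite.partitionFunction_eq_layercake` — `Z(c) = ∫_{u>0} Haar^{⊗E}{u ≤ e^{−cS}} du` (Mathlib's layer
  cake `lintegral_eq_lintegral_meas_le`), and `OneSite.setOf_le_exp_eq` — `{u ≤ e^{−cS}} = {S ≤ −log u/c}`;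
* `OneSite.partitionFunction_quarter_le` — on ANY torus `(ℤ/L)⁴`: if `Haar^{⊗E}{S ≤ t} ≤ K·Haar^{⊗E}{S ≤ t/4}`
  for `0 < t ≤ t₀`, then for every `b > 0`
  `Z(b/4) ≤ (K + 1 + 1/Haar^{⊗E}{S ≤ t₀/4}) · Z(b)`:
  in the layer-cake variable `u = e^{−bt}` the two integrands are the sublevel volumes at `4t` and `t`;
  for `u ≥ e^{−bt₀/4}` one doubling step applies (and `{S ≤ 4t} ⊆ {S ≤ t}` when `t ≤ 0`), the range
  `u < e^{−bt₀/4}` has Lebesgue measure `e^{−bt₀/4} ≤ Z(b)/Haar^{⊗E}{S ≤ t₀/4}` (Laplace lower bound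
  `exp_mul_measureReal_le_integral_exp`);
* `oneSite_partitionFunction_doubling` (registered sub-goal, `--supports stmt-QuantumFields-16204`) — for
  every compact `G` and lattice representation `r`: ONE `K` with `Z₁(b/4) ≤ K·Z₁(b)` for ALL `b > 0`, from
  the landed one-site sublevel doubling (`stub_sublevelDoubling` at `L = 1`, cf. `commutatorCost_sublevelDoubling`).

Elementary; Mathlib + landed tree lemmas only; no named facts, no definitions.
-/

set_option autoImplicit false

noncomputable section

open scoped ENNReal NNReal
open MeasureTheory Set Literature.MathematicalPhysics.QuantumFieldTheory

namespace Summit.QuantumFields.YangMills.Theorems.FemtoCurvatureTwoPointC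

namespace OneSite

variable {G : Type*} [Group G] [TopologicalSpace G] [IsTopologicalGroup G] [CompactSpace G]
  [MeasurableSpace G] [BorelSpace G] {N : ℕ} (ρ : G →* Matrix (Fin N) (Fin N) ℂ)

/-- `Z(β) = ∫ e^{−βS} dHaar^{⊗E}` as a lower Lebesgue integral (definition unfolding). [folklore] -/
theorem partitionFunction_eq_lintegral' {L : ℕ} [NeZero L] (β : ℝ) :
    partitionFunction (d := 4) (L := L) ρ β =
      ∫⁻ U, ENNReal.ofReal (Real.exp (-β * wilsonAction ρ U))
        ∂(Measure.pi fun _ : Edge 4 L => haarProbability G) := by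
  simp only [partitionFunction, wilsonWeight, withDensity_apply _ MeasurableSet.univ,
    Measure.restrict_univ]

/-- **Layer-cake form of the partition function**: `Z(c) = ∫_{u > 0} Haar^{⊗E}{U | u ≤ e^{−c S(U)}} du`.
[folklore] -/
theorem partitionFunction_eq_layercake {L : ℕ} [NeZero L] (hρ : Continuous ρ) (c : ℝ) :
    partitionFunction (d := 4) (L := L) ρ c =
      ∫⁻ u in Ioi (0 : ℝ), (Measure.pi fun _ : Edge 4 L => haarProbability G)
        {U : GaugeConfig 4 L G | u ≤ Real.exp (-c * wilsonAction ρ U)} := by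
  rw [partitionFunction_eq_lintegral']
  exact lintegral_eq_lintegral_meas_le _ (ae_of_all _ fun U => (Real.exp_pos _).le)
    (Real.measurable_exp.comp ((WilsonRP.measurable_wilsonAction ρ hρ).const_mul _)).aemeasurable

omit [TopologicalSpace G] [IsTopologicalGroup G] [CompactSpace G] [MeasurableSpace G] [BorelSpace G] in
/-- The layer-cake sets are sublevel sets of the action: `{u ≤ e^{−cS}} = {S ≤ −log u / c}` for
`u, c > 0`. [folklore] -/
theorem setOf_le_exp_eq {L : ℕ} [NeZero L] {u c : ℝ} (hu : 0 < u) (hc : 0 < c) :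
    {U : GaugeConfig 4 L G | u ≤ Real.exp (-c * wilsonAction ρ U)} =
      {U : GaugeConfig 4 L G | wilsonAction ρ U ≤ -Real.log u / c} := by
  ext U
  simp only [mem_setOf_eq]
  rw [← Real.log_le_iff_le_exp hu, le_div_iff₀ hc]
  constructor <;> intro h <;> linarith

/-- **Sublevel doubling ⇒ partition-function doubling at EVERY temperature** on a fixed torus
`(ℤ/L)⁴`: if `Haar^{⊗E}{S ≤ t} ≤ K · Haar^{⊗E}{S ≤ t/4}` for `0 < t ≤ t₀`, then for all `b > 0`
`Z(b/4) ≤ (K + 1 + 1/Haar^{⊗E}{S ≤ t₀/4}) · Z(b)` (layer cake; one doubling step for `u ≥ e^{−bt₀/4}`;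
the small-`u` range costs `e^{−bt₀/4} ≤ Z(b)/Haar^{⊗E}{S ≤ t₀/4}`). [folklore] -/
theorem partitionFunction_quarter_le {L : ℕ} [NeZero L] (hρ : Continuous ρ)
    (hρN : ∀ g, (ρ g).trace.re ≤ N) {K : ℝ≥0} {t₀ : ℝ} (ht₀ : 0 < t₀)
    (hdbl : ∀ t : ℝ, 0 < t → t ≤ t₀ →
      Measure.pi (fun _ : Edge 4 L => haarProbability G)
          {U : GaugeConfig 4 L G | wilsonAction ρ U ≤ t} ≤
        K * Measure.pi (fun _ : Edge 4 L => haarProbability G)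
          {U : GaugeConfig 4 L G | wilsonAction ρ U ≤ t / 4})
    {b : ℝ} (hb : 0 < b) :
    (partitionFunction (d := 4) (L := L) ρ (b / 4)).toReal ≤
      ((K : ℝ) + 1 + 1 / (Measure.pi fun _ : Edge 4 L => haarProbability G).real
          {U : GaugeConfig 4 L G | wilsonAction ρ U ≤ t₀ / 4}) *
        (partitionFunction (d := 4) (L := L) ρ b).toReal := by
  set π : Measure (GaugeConfig 4 L G) := Measure.pi fun _ : Edge 4 L => haarProbability G with hπ
  set a : ℝ := Real.exp (-(b * t₀ / 4)) with ha
  -- the layer-cake integrands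
  set g : ℝ → ℝ → ℝ≥0∞ := fun c u =>
    π {U : GaugeConfig 4 L G | u ≤ Real.exp (-c * wilsonAction ρ U)} with hg
  -- (1) pointwise comparison on `u > 0`
  have hpt : ∀ u : ℝ, 0 < u →
      g (b / 4) u ≤ ((K : ℝ≥0∞) + 1) * g b u + (Iio a).indicator (1 : ℝ → ℝ≥0∞) u := by
    intro u hu
    by_cases hua : u < a
    · -- small `u`: the integrand is at most `1`
      have h1 : (Iio a).indicator (1 : ℝ → ℝ≥0∞) u = 1 := by
        rw [indicator_of_mem (mem_Iio.2 hua), Pi.one_apply]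
      rw [h1]
      exact (prob_le_one).trans le_add_self
    · replace hua : a ≤ u := not_lt.1 hua
      set t : ℝ := -Real.log u / b with ht
      have hb4 : 0 < b / 4 := by positivity
      have hset4 : {U : GaugeConfig 4 L G | u ≤ Real.exp (-(b / 4) * wilsonAction ρ U)} =
          {U : GaugeConfig 4 L G | wilsonAction ρ U ≤ 4 * t} := by
        rw [setOf_le_exp_eq ρ hu hb4, ht, div_div_eq_mul_div]
        ext U
        simp only [mem_setOf_eq]
        rw [show -Real.log u * 4 / b = 4 * (-Real.log u / b) by ring]
      have hset1 : {U : GaugeConfig 4 L G | u ≤ Real.exp (-b * wilsonAction ρ U)} =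
          {U : GaugeConfig 4 L G | wilsonAction ρ U ≤ t} := setOf_le_exp_eq ρ hu hb
      -- `a ≤ u` means `4t ≤ t₀`
      have h4t : 4 * t ≤ t₀ := by
        have hlog : -(b * t₀ / 4) ≤ Real.log u := by
          have h := Real.log_le_log (Real.exp_pos (-(b * t₀ / 4))) hua
          rwa [Real.log_exp] at h
        rw [ht, show 4 * (-Real.log u / b) = (-Real.log u) * 4 / b by ring, div_le_iff₀ hb]
        nlinarith
      have hmono : g (b / 4) u ≤ ((K : ℝ≥0∞) + 1) * g b u := by
        show π {U : GaugeConfig 4 L G | u ≤ Real.exp (-(b / 4) * wilsonAction ρ U)} ≤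
          ((K : ℝ≥0∞) + 1) * π {U : GaugeConfig 4 L G | u ≤ Real.exp (-b * wilsonAction ρ U)}
        rw [hset4, hset1]
        rcases le_or_gt t 0 with ht0 | ht0
        · calc π {U : GaugeConfig 4 L G | wilsonAction ρ U ≤ 4 * t}
              ≤ π {U : GaugeConfig 4 L G | wilsonAction ρ U ≤ t} :=
                measure_mono fun U (hU : wilsonAction ρ U ≤ 4 * t) =>
                  show wilsonAction ρ U ≤ t by linarith
            _ = 1 * π {U : GaugeConfig 4 L G | wilsonAction ρ U ≤ t} := (one_mul _).symm
            _ ≤ ((K : ℝ≥0∞) + 1) * π {U : GaugeConfig 4 L G | wilsonAction ρ U ≤ t} :=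
                mul_le_mul' le_add_self le_rfl
        · have h := hdbl (4 * t) (by positivity) h4t
          rw [show 4 * t / 4 = t by ring] at h
          calc π {U : GaugeConfig 4 L G | wilsonAction ρ U ≤ 4 * t}
              ≤ K * π {U : GaugeConfig 4 L G | wilsonAction ρ U ≤ t} := h
            _ ≤ ((K : ℝ≥0∞) + 1) * π {U : GaugeConfig 4 L G | wilsonAction ρ U ≤ t} :=
                mul_le_mul' le_self_add le_rfl
      exact hmono.trans le_self_add
  -- (2) integrate over `u > 0`
  have hZ4 : partitionFunction (d := 4) (L := L) ρ (b / 4) = ∫⁻ u in Ioi (0 : ℝ), g (b / 4) u :=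
    partitionFunction_eq_layercake ρ hρ _
  have hZ1 : partitionFunction (d := 4) (L := L) ρ b = ∫⁻ u in Ioi (0 : ℝ), g b u :=
    partitionFunction_eq_layercake ρ hρ _
  have hind : Measurable fun u : ℝ => (Iio a).indicator (1 : ℝ → ℝ≥0∞) u :=
    measurable_one.indicator measurableSet_Iio
  have hvol : ∫⁻ u in Ioi (0 : ℝ), (Iio a).indicator (1 : ℝ → ℝ≥0∞) u = ENNReal.ofReal a := by
    rw [lintegral_indicator_one measurableSet_Iio, Measure.restrict_apply measurableSet_Iio,
      Iio_inter_Ioi, Real.volume_Ioo, sub_zero]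
  have hK : ((K : ℝ≥0∞) + 1) ≠ ∞ := by simp
  have hint : partitionFunction (d := 4) (L := L) ρ (b / 4) ≤
      ((K : ℝ≥0∞) + 1) * partitionFunction (d := 4) (L := L) ρ b + ENNReal.ofReal a := by
    rw [hZ4, hZ1, ← hvol, ← lintegral_const_mul' _ _ hK, ← lintegral_add_right _ hind]
    exact setLIntegral_mono' measurableSet_Ioi fun u hu => hpt u hu
  -- (3) back to real numbers
  have hS0 : ∀ U : GaugeConfig 4 L G, 0 ≤ wilsonAction ρ U := fun U =>
    wilsonAction_nonneg_of_re_trace_le ρ hρN U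
  have hZle : partitionFunction (d := 4) (L := L) ρ b ≤ 1 := by
    rw [partitionFunction_eq_lintegral']
    calc _ ≤ ∫⁻ _U, (1 : ℝ≥0∞) ∂π := lintegral_mono fun U => by
            rw [← ENNReal.ofReal_one]
            exact ENNReal.ofReal_le_ofReal (Real.exp_le_one_iff.2 (by nlinarith [hS0 U]))
      _ = 1 := by rw [lintegral_const, measure_univ, mul_one]
  have hZtop : partitionFunction (d := 4) (L := L) ρ b ≠ ∞ := ne_top_of_le_ne_top ENNReal.one_ne_top hZle
  have hRtop : ((K : ℝ≥0∞) + 1) * partitionFunction (d := 4) (L := L) ρ b + ENNReal.ofReal a ≠ ∞ :=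
    ENNReal.add_ne_top.2 ⟨ENNReal.mul_ne_top hK hZtop, ENNReal.ofReal_ne_top⟩
  have ha0 : 0 ≤ a := (Real.exp_pos _).le
  have hreal : (partitionFunction (d := 4) (L := L) ρ (b / 4)).toReal ≤
      ((K : ℝ) + 1) * (partitionFunction (d := 4) (L := L) ρ b).toReal + a := by
    have h := ENNReal.toReal_mono hRtop hint
    rw [ENNReal.toReal_add (ENNReal.mul_ne_top hK hZtop) ENNReal.ofReal_ne_top, ENNReal.toReal_mul,
      ENNReal.toReal_ofReal ha0, ENNReal.toReal_add ENNReal.coe_ne_top ENNReal.one_ne_top,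
      ENNReal.coe_toReal, ENNReal.toReal_one] at h
    exact h
  -- (4) the small-`u` cost: `a ≤ Z(b) / Haar{S ≤ t₀/4}`
  set p : ℝ := π.real {U : GaugeConfig 4 L G | wilsonAction ρ U ≤ t₀ / 4} with hp
  have hppos : 0 < p := measureReal_wilsonAction_le_pos ρ hρ (by positivity)
  have hlap : a * p ≤ (partitionFunction (d := 4) (L := L) ρ b).toReal := by
    rw [partitionFunction_toReal_eq_integral ρ hρ b, ha, hp,
      show -(b * t₀ / 4) = -b * (t₀ / 4) by ring]
    exact exp_mul_measureReal_le_integral_exp ρ hρ hb.le (t₀ / 4)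
  have hale : a ≤ (partitionFunction (d := 4) (L := L) ρ b).toReal / p := by
    rwa [le_div_iff₀ hppos]
  have hZ0 : 0 ≤ (partitionFunction (d := 4) (L := L) ρ b).toReal := ENNReal.toReal_nonneg
  calc (partitionFunction (d := 4) (L := L) ρ (b / 4)).toReal
      ≤ ((K : ℝ) + 1) * (partitionFunction (d := 4) (L := L) ρ b).toReal +
          (partitionFunction (d := 4) (L := L) ρ b).toReal / p := by linarith
    _ = ((K : ℝ) + 1 + 1 / p) * (partitionFunction (d := 4) (L := L) ρ b).toReal := by ring

end OneSite

/-- **Registered sub-goal `oneSite_partitionFunction_doubling` — input M1 of the V-corner route of line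
`conditional-covariance-floor`: the ONE-SITE partition function doubles at every temperature.** For every
compact group `G` (any Borel structure) with a lattice representation `r` there is ONE `K` with
`Z₁(b/4) ≤ K · Z₁(b)` for ALL `b > 0`, `Z₁(b) = partitionFunction (L := 1) r.ρ b = ∫_{G⁴} e^{−b f} dHaar^{⊗4}`
the one-site (`(ℤ/1)⁴`) Wilson partition function of the commutator cost `f` — from the landed one-site
sublevel doubling (`stub_sublevelDoubling` at `L = 1`) by `OneSite.partitionFunction_quarter_le`. -/
theorem oneSite_partitionFunction_doubling :
    ∀ (G : Type) [Group G] [TopologicalSpace G] [IsTopologicalGroup G] [CompactSpace G]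
      [MeasurableSpace G] [BorelSpace G] (r : LatticeRep G),
      ∃ K : ℝ, ∀ b : ℝ, 0 < b →
        (partitionFunction (d := 4) (L := 1) r.ρ (b / 4)).toReal ≤
          K * (partitionFunction (d := 4) (L := 1) r.ρ b).toReal := by
  intro G _ _ _ _ _ _ r
  obtain ⟨K, t₀, ht₀, h⟩ :=
    stub_sublevelDoubling stub_expCommutatorBracket stub_koszulH1 stub_haarCoLipschitz G r 1
  have hρN : ∀ g, (r.ρ g).trace.re ≤ r.N := fun g => by
    have h := Literature.RepresentationTheory.CompactGroups.CompactGroup.abs_re_trace_le_card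
      r.ρ r.continuous g
    rw [Fintype.card_fin] at h
    exact (abs_le.1 h).2
  exact ⟨_, fun b hb => OneSite.partitionFunction_quarter_le r.ρ r.continuous hρN ht₀ h hb⟩

end Summit.QuantumFields.YangMills.Theorems.FemtoCurvatureTwoPointC

end
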